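import Summits.QuantumFields.BalabanUV.T4Continuum.Spine.NE7.QLaAbelianBlockModel
import Summits.QuantumFields.BalabanUV.T4Continuum.Spine.NE7.QLaHolonomyDefect

/-!
# Spine/NE7/QLaAbelianBlockContraction — NE1a-STEP WITH `θ = L^{1−d}` FOR ALL CONFIGURATIONS in the abelian (0.4) block model,
# hence `HolDevBound` ∕ `LoopDefectBound` with EVERY hypothesis discharged and the NODE-S exponent `a = θ²·L^d = L^{2−d}`
# (= `L⁻²` in `d = 4`, `< 1`) inhabited end to end

Cell `pub-balaban-gaps` (YM blitz Y1, track G2, seat `ne7`, generation 4); text of record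
`run/shared/lean/pub/pub-balaban-gaps/ne/NE7.md` v4 §4quinquies, census rows R32–R40.  Tenth `Spine/NE7/` file — the companion of
`QLaAbelianBlockModel` (which builds the abelian exp-mean-log block averaging `linAvg` of [Balaban1987RG1] (0.4) as a
`Setup.Averaging` and the torus geometry of its loops) and of `QLaHolonomyDefect` (the gauge-invariant holonomy-level shape
`HolDevBound` NODE S consumes).

WHAT IS PROVED (all [folklore], kernel-checked, 0 sorry):
* `ph_loopHol`: the phase of the (0.4) loop variable `U(Γ ∪ [x,x′] ∪ (−Γ′) ∪ (−c))` decomposes as (staircase at `c₋`) +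
  (transported bond) − (staircase at `c₊`) − (phase of `U(c)`); in the mean over the index set the transporter `U(c)` CANCELS and
  the staircase means `λ(U, y)` (`stairMean`) depend on the coarse SITE only (`loopMean_eq`, `linAvgFun_ph`).
* `bdist_linAvgFun_gaugeFix`: the coarse gauge transformation `y ↦ −λ(U⁻¹U′, y)` removes the staircases EXACTLY, leaving the mean
  of the transported-bond phases of the quotient configuration — the kernel form of the cell record's «the gauge transformation is
  essential: a root-contour bond moves the block variables by O(1) … only the residual is small» (`T4AvgDerivBound.AvgStepContraction`
  docstring; `t4/T4-EST-O3cE2.md` §2).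
* `sum_abs_segPh_le`: summed over all coarse bonds, the transported-bond phases carry at most `L ×` the `ℓ¹` norm (column
  multiplicity `L`, `QLaAbelianBlockModel.sum_segBond_le` — [Balaban1985Averaging] Prop. 5 (156) with (138) at the flat configuration).
* **`avgStepContraction_linAvg`: NE1a-STEP (`T4AvgDerivBound.AvgStepContraction`) holds for `linAvg` on ALL configurations with
  `θ = L·L^{−d} = L^{1−d}`** — the `pub-balaban` record's [toy computation] «θ_step = L^{1−d} EXACTLY … residual on ≤ 2 coarse
  bonds» (`t4/T4-EST-O3cE2.md` §0(d)∕§2, engine `ne1a_lin_tv.py`: (d,L) ∈ {(2,2),(2,3),(2,4),(3,2),(3,3),(4,2),(4,3)}, exact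
  rationals, B5 (1.6)–(1.7) corner contours) as a theorem — for B12's centred symmetric (0.4) contours — for every `d ≥ 1`, odd
  `L > 1`, every level of the standing range, every pair of
  configurations; the shape NE1a-STEP (NOT PRINTED as typed) is thereby inhabited with `θ < 1` for the first time in the tree (the
  axial decimation of `QLaCriticalityAxial` gives `θ = 1`).
* `holDevBound_linAvg`, `loopDefectBound_linAvg`, `loopDefect_linAvg_explicit`: the holonomy deviation bound of `QLaHolonomyDefect`
  (`Ch = 1`) and generation 3's second-order loop defect bound (`Cd = ½`) for `linAvg`, NO hypothesis left:
  `1 − cos(phase of 𝒰_w(avgⁿ V)) ≤ ½·(|w|·tv(1,V)·(L^{1−d})ⁿ)²`.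
* `abs_log_quotient_sub_le_linAvg`: THE NODE-S CHAIN END TO END in the model — for ANY two probability laws on configurations
  supported in a finite bond set `Λ` with one-bond deviations `≤ D` (which laws is NODE O's business) the `t`-discrepancy of the
  log-quotient of the rider-tilted laws is `≤ 2|t|·½(|w|·|Λ|·D)²·(θ²)ⁿ` (generation 3's `abs_log_integral_exp_sub_le` ∘
  `loopDefect_le_of_support`, every averaging hypothesis discharged): `QLaPt` with `b = θ² = L^{2−2d}`.
* exponent bookkeeping: `theta_sq_mul_vol` (`θ²·L^d = L^{2−d}`), `theta_eq_of_d_eq_four` (`θ = L⁻³ = θ₁` of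
  `T4LoopPullback.theta1_exact`), `rate_linAvg_lt_one` (`d = 4`: `a = θ²·L⁴ = L⁻² < 1` by `Spine.NE7.rate_secondOrder_lt_one`,
  p340302) — the NODE-S chain criticality → `QLaPt` (`b = θ²`) → `QLa` (`a = θ²Λ`) carries the summable exponent in a realised
  instance.

HONEST FRAMING.  A MODEL INSTANCE (abelian, Lie-algebra valued, no compactness, no small-field domains): it certifies that the
hypothesis shapes NE1a-STEP ∕ `HolDevBound` ∕ `LoopDefectBound` are jointly satisfiable WITH A CONTRACTING RATE by an averaging of
the printed (0.4) shape and exhibits the mechanism (staircases = coarse gauge, transported bonds = column multiplicity `L`).  It says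
NOTHING about the non-abelian corrections of [Balaban1985Averaging] (15) (commutators; Props 1–5; the (52)/(158) domains), which
remain the located content of NE1a-STEP for `SU(N)`; nothing of Bałaban's densities, R-operation or (1.100) insert is touched.
(QL-a) NOT IN PRINT ([Balaban1989LargeFieldII] p. 356 defers observables); NE7 NOT proved; spine 0∕9; fixed finite T⁴ — NOT ℝ⁴,
NOT infinite volume, NOT a mass gap, NOT Clay.
-/

noncomputable section

open Finset
open scoped BigOperators

namespace Summit.QuantumFields.BalabanUV.T4Continuum.Spine.NE7

open Literature.MathematicalPhysics.QuantumFieldTheory.Balaban1983to89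
open Literature.MathematicalPhysics.QuantumFieldTheory.Balaban1983to89.T4Continuum
open Literature.MathematicalPhysics.QuantumFieldTheory.Balaban1983to89.T4AvgSensitivity
open Literature.MathematicalPhysics.QuantumFieldTheory.Balaban1983to89.T4AvgDerivBound
open Literature.MathematicalPhysics.QuantumFieldTheory.Balaban1983to89.BlockAveraging (Idx off loopHol)
open Literature.MathematicalPhysics.QuantumFieldTheory.Balaban1983to89.AveragingRT (axialAvg)
open LinPhase

/-! ## §5 NE1a-STEP with `θ = L^{1−d}` for ALL configurations: the staircases are a coarse gauge transformation, the transported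
bonds have column multiplicity `L` -/

section Contraction

variable {P : Params} {j : ℕ}

/-- THE STAIRCASE MEAN `λ(U, y)`: the mean over the index set of the phases of the staircases `Γ ∈ G(y, x)` from the block
centre — a function of the COARSE SITE `y` only; it is the coarse gauge transformation NE1a-STEP quotients out. [folklore] -/
def stairMean (U : GaugeField P j LinPhase) (y : Site P (j + 1)) : ℝ :=
  (Fintype.card (Idx P) : ℝ)⁻¹ * ∑ i : Idx P, (holAt U (walk (emb y) (stairWord i.2.1 (off i.1)))).ph

/-- THE PHASE OF THE TRANSPORTED BOND `[x, x′]`, `x = blockSite c₋ r`. [folklore] -/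
def segPh (U : GaugeField P j LinPhase) (c : PBond P (j + 1)) (r : Fin P.d → Fin P.L) : ℝ :=
  (holAt U (walk (Site.blockSite c.src r) (List.replicate P.L (c.dir, true)))).ph

/-- The segment `(−c)` of the loop word transports by `U(c)⁻¹`. [folklore] -/
theorem holAt_emb_tgt_replicate_false (U : GaugeField P j LinPhase) (c : PBond P (j + 1)) :
    holAt U (walk (emb c.tgt) (List.replicate P.L (c.dir, false))) = (axialAvg U c)⁻¹ := by
  have hrev : List.replicate P.L (c.dir, false) = wordRev (List.replicate P.L (c.dir, true)) := by
    rw [wordRev_replicate]; rfl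
  have h4 : emb c.tgt = walkEnd (emb c.src) (List.replicate P.L (c.dir, true)) := (walkEnd_replicate_L c.src c.dir).symm
  rw [hrev, h4, holAt_walk_wordRev, ← axialAvg_eq_holAt_walk]

/-- **THE LOOP PHASE DECOMPOSES**: phase of `U(Γ ∪ [x,x′] ∪ (−Γ′) ∪ (−c))` = (staircase at `c₋`) + (transported bond) −
(staircase at `c₊`) − (phase of `U(c)`), standing range (the endpoints: `walkEnd_emb_stairWord`, `walkEnd_blockSite_replicate`,
tree `walkEnd_walkEnd_wordRev`, `holAt_walk_wordRev`). [folklore] -/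
theorem ph_loopHol (hj : j + 1 ≤ P.m + P.K) (U : GaugeField P j LinPhase) (c : PBond P (j + 1)) (i : Idx P) :
    (loopHol U c i).ph = (holAt U (walk (emb c.src) (stairWord i.2.1 (off i.1)))).ph + segPh U c i.1
      - (holAt U (walk (emb c.tgt) (stairWord i.2.2 (off i.1)))).ph - (axialAvg U c).ph := by
  obtain ⟨r, σ, σ'⟩ := i
  have h1 : walkEnd (emb c.src) (stairWord σ (off r)) = Site.blockSite c.src r := walkEnd_emb_stairWord _ _ _
  have h2 : walkEnd (Site.blockSite c.src r) (List.replicate P.L (c.dir, true)) =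
      walkEnd (emb c.tgt) (stairWord σ' (off r)) := by
    rw [walkEnd_blockSite_replicate hj, walkEnd_emb_stairWord]
    rfl
  unfold loopHol
  dsimp only
  rw [loopWord, walk_append, holAt_append, walk_append, holAt_append, walk_append, holAt_append, h1, h2,
    holAt_walk_wordRev, walkEnd_walkEnd_wordRev, holAt_emb_tgt_replicate_false]
  simp only [mul_ph, inv_ph, segPh]
  ring

/-- **THE EXPONENT OF (0.4), RESOLVED**: `loopMean U c = λ(U, c₋) + L^{-d}·Σ_r (transported bond phases)·(…) − λ(U, c₊) −
(phase of U(c))` — the second ordering `σ′` is exchanged for the first by the swap symmetry of the index set. [folklore] -/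
theorem loopMean_eq (hj : j + 1 ≤ P.m + P.K) (U : GaugeField P j LinPhase) (c : PBond P (j + 1)) :
    loopMean U c = stairMean U c.src + (Fintype.card (Idx P) : ℝ)⁻¹ * ∑ i : Idx P, segPh U c i.1
      - stairMean U c.tgt - (axialAvg U c).ph := by
  have hN : (Fintype.card (Idx P) : ℝ) ≠ 0 := (card_idx_pos P).ne'
  have hswap : ∑ i : Idx P, (holAt U (walk (emb c.tgt) (stairWord i.2.2 (off i.1)))).ph
      = ∑ i : Idx P, (holAt U (walk (emb c.tgt) (stairWord i.2.1 (off i.1)))).ph :=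
    Fintype.sum_equiv ((Equiv.refl _).prodCongr (Equiv.prodComm _ _)) _ _ fun _ => rfl
  unfold loopMean stairMean
  simp only [ph_loopHol hj, Finset.sum_sub_distrib, Finset.sum_add_distrib, Finset.sum_const, Finset.card_univ,
    nsmul_eq_mul, hswap]
  field_simp

/-- **THE COARSE BOND PHASE**: `(Ū(c)).ph = λ(U, c₋) + L^{-d}Σ… − λ(U, c₊)` — the straight transporter `U(c)` CANCELS against the
segment `(−c)` of the loops. [folklore] -/
theorem linAvgFun_ph (hj : j + 1 ≤ P.m + P.K) (U : GaugeField P j LinPhase) (c : PBond P (j + 1)) :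
    (linAvgFun U c).ph = stairMean U c.src + (Fintype.card (Idx P) : ℝ)⁻¹ * ∑ i : Idx P, segPh U c i.1
      - stairMean U c.tgt := by
  simp only [linAvgFun, mul_ph, loopMean_eq hj]
  ring

/-- Linearity of the staircase mean in the quotient configuration. [folklore] -/
theorem stairMean_quot (U U' : GaugeField P j LinPhase) (y : Site P (j + 1)) :
    stairMean (quot U U') y = stairMean U' y - stairMean U y := by
  unfold stairMean
  simp only [ph_holAt_quot, Finset.sum_sub_distrib, mul_sub]

/-- Linearity of the transported-bond phase in the quotient configuration. [folklore] -/
theorem segPh_quot (U U' : GaugeField P j LinPhase) (c : PBond P (j + 1)) (r : Fin P.d → Fin P.L) :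
    segPh (quot U U') c r = segPh U' c r - segPh U c r := by
  unfold segPh
  rw [ph_holAt_quot]

/-- **GAUGE-FIXING THE STAIRCASES**: after the coarse gauge transformation `y ↦ −λ(U⁻¹U′, y)`, the change of the coarse bond
variable at `c` is EXACTLY the mean of the transported-bond phases of the quotient configuration. [folklore] -/
theorem bdist_linAvgFun_gaugeFix (hj : j + 1 ≤ P.m + P.K) (U U' : GaugeField P j LinPhase) (c : PBond P (j + 1)) :
    bdist (linAvgFun U c)
        (GaugeField.gaugeAct (fun y => (⟨-stairMean (quot U U') y⟩ : LinPhase)) (linAvgFun U') c)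
      = |(Fintype.card (Idx P) : ℝ)⁻¹ * ∑ i : Idx P, segPh (quot U U') c i.1| := by
  rw [bdist_eq]
  simp only [GaugeField.gaugeAct, mul_ph, inv_ph, linAvgFun_ph hj, stairMean_quot, segPh_quot,
    Finset.sum_sub_distrib]
  congr 1
  ring

/-- The transported-bond phase is bounded by the `ℓ¹` mass of its `L` bonds. [folklore] -/
theorem abs_segPh_le (U : GaugeField P j LinPhase) (c : PBond P (j + 1)) (r : Fin P.d → Fin P.L) :
    |segPh U c r| ≤ ∑ t ∈ Finset.range P.L, |(U (segBond c r t)).ph| := by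
  unfold segPh
  rw [ph_holAt_replicate]
  exact Finset.abs_sum_le_sum_abs _ _

/-- THE COLUMN BOUND: summed over all coarse bonds and the whole index set, the transported-bond phases of a configuration
carry at most `|S_d × S_d| · L ·` (its `ℓ¹` norm) — multiplicity `L` per fine bond (`sum_segBond_le`). [folklore] -/
theorem sum_abs_segPh_le (hj : j + 1 ≤ P.m + P.K) (Q : GaugeField P j LinPhase) :
    ∑ c : PBond P (j + 1), ∑ i : Idx P, |segPh Q c i.1|
      ≤ (Fintype.card (Equiv.Perm (Fin P.d) × Equiv.Perm (Fin P.d)) : ℝ) *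
          ((P.L : ℝ) * ∑ b : PBond P j, |(Q b).ph|) := by
  set cP : ℝ := (Fintype.card (Equiv.Perm (Fin P.d) × Equiv.Perm (Fin P.d)) : ℝ) with hcP
  have hcP0 : 0 ≤ cP := Nat.cast_nonneg _
  have hswap : ∀ c : PBond P (j + 1),
      ∑ r : Fin P.d → Fin P.L, ∑ t ∈ Finset.range P.L, |(Q (segBond c r t)).ph|
        = ∑ t ∈ Finset.range P.L, ∑ r : Fin P.d → Fin P.L, |(Q (segBond c r t)).ph| := fun c => Finset.sum_comm
  calc ∑ c : PBond P (j + 1), ∑ i : Idx P, |segPh Q c i.1|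
      = ∑ c : PBond P (j + 1), cP * ∑ r : Fin P.d → Fin P.L, |segPh Q c r| :=
        Finset.sum_congr rfl fun c _ => sum_idx_of_fst (fun r => |segPh Q c r|)
    _ = cP * ∑ c : PBond P (j + 1), ∑ r : Fin P.d → Fin P.L, |segPh Q c r| := by rw [Finset.mul_sum]
    _ ≤ cP * ∑ c : PBond P (j + 1), ∑ r : Fin P.d → Fin P.L, ∑ t ∈ Finset.range P.L, |(Q (segBond c r t)).ph| :=
        mul_le_mul_of_nonneg_left
          (Finset.sum_le_sum fun c _ => Finset.sum_le_sum fun r _ => abs_segPh_le Q c r) hcP0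
    _ = cP * ∑ t ∈ Finset.range P.L, ∑ c : PBond P (j + 1), ∑ r : Fin P.d → Fin P.L, |(Q (segBond c r t)).ph| := by
        rw [Finset.sum_congr rfl fun c _ => hswap c, Finset.sum_comm]
    _ ≤ cP * ∑ _t ∈ Finset.range P.L, ∑ b : PBond P j, |(Q b).ph| :=
        mul_le_mul_of_nonneg_left
          (Finset.sum_le_sum fun t _ => sum_segBond_le hj t (fun b => |(Q b).ph|) fun b => abs_nonneg _) hcP0
    _ = cP * ((P.L : ℝ) * ∑ b : PBond P j, |(Q b).ph|) := by
        rw [Finset.sum_const, Finset.card_range, nsmul_eq_mul]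

/-- The one-step rate of the model, `θ = L · L^{−d} = L^{1−d}`. [folklore] -/
def theta (P : Params) : ℝ := (P.L : ℝ) * ((P.L : ℝ) ^ P.d)⁻¹

/-- `0 ≤ θ`. [folklore] -/
theorem theta_nonneg (P : Params) : 0 ≤ theta P := by unfold theta; positivity

/-- **NE1a-STEP IN THE ABELIAN MODEL, ALL CONFIGURATIONS, ALL `(d, L)`** (kernel theorem): Bałaban's (0.4) block averaging with
the exact logarithm CONTRACTS TOTAL VARIATION BY `θ = L^{1−d}` MODULO THE COARSE GAUGE TRANSFORMATION `y ↦ −λ(U⁻¹U′, y)`: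
`AvgStepContraction (fun _ => linAvg) (fun _ => univ) (L·L^{−d})`.  The `pub-balaban` cell's [toy computation] record
(`t4/T4-EST-O3cE2.md` §0(d)∕§2, engine `ne1a_lin_tv.py`, (d,L) ∈ {(2,2),(2,3),(2,4),(3,2),(3,3),(4,2),(4,3)}, exact rationals, B5
(1.6)–(1.7) corner contours: «θ_step = L^{1−d} EXACTLY, residual supported on ≤ 2 coarse bonds»; the SU(2) one-step toy of
`t4/T4-RUNG-O3c1.md` PART C agrees at flat) as a theorem — for B12's centred symmetric (0.4) contours — for every `d ≥ 1`, odd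
`L > 1`, every torus of the standing range, EVERY pair of configurations
(no small-field hypothesis: the model is abelian).  The hypothesis shape `T4AvgDerivBound.AvgStepContraction` (NE1a-STEP, NOT
PRINTED as typed) is thereby inhabited with `θ < 1` for the first time in the tree (the axial decimation gives only `θ = 1`).
HONEST: the non-abelian corrections of [Balaban1985Averaging] (15) (commutators; Props 1–5) are NOT touched. [folklore] -/
theorem avgStepContraction_linAvg :
    AvgStepContraction (fun k => (linAvg : Averaging P k LinPhase)) (fun _ => Set.univ) (theta P) := by
  intro j hj U U' _ _
  refine ⟨fun y => ⟨-stairMean (quot U U') y⟩, ?_⟩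
  have hN0 : (0 : ℝ) < Fintype.card (Idx P) := card_idx_pos P
  have hLd : (0 : ℝ) < (P.L : ℝ) ^ P.d := by have := P.L_pos; positivity
  show tv (linAvgFun U) _ ≤ _
  calc tv (linAvgFun U) (GaugeField.gaugeAct (fun y => (⟨-stairMean (quot U U') y⟩ : LinPhase)) (linAvgFun U'))
      = ∑ c : PBond P (j + 1), |(Fintype.card (Idx P) : ℝ)⁻¹ * ∑ i : Idx P, segPh (quot U U') c i.1| :=
        Finset.sum_congr rfl fun c _ => bdist_linAvgFun_gaugeFix hj U U' c
    _ ≤ ∑ c : PBond P (j + 1), (Fintype.card (Idx P) : ℝ)⁻¹ * ∑ i : Idx P, |segPh (quot U U') c i.1| := by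
        refine Finset.sum_le_sum fun c _ => ?_
        rw [abs_mul, abs_inv, abs_of_pos hN0]
        exact mul_le_mul_of_nonneg_left (Finset.abs_sum_le_sum_abs _ _) (inv_nonneg.mpr hN0.le)
    _ = (Fintype.card (Idx P) : ℝ)⁻¹ * ∑ c : PBond P (j + 1), ∑ i : Idx P, |segPh (quot U U') c i.1| := by
        rw [Finset.mul_sum]
    _ ≤ (Fintype.card (Idx P) : ℝ)⁻¹ * ((Fintype.card (Equiv.Perm (Fin P.d) × Equiv.Perm (Fin P.d)) : ℝ) *
          ((P.L : ℝ) * ∑ b : PBond P j, |(quot U U' b).ph|)) :=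
        mul_le_mul_of_nonneg_left (sum_abs_segPh_le hj (quot U U')) (inv_nonneg.mpr hN0.le)
    _ = theta P * tv U U' := by
        rw [tv_eq_sum_abs, card_idx, theta]
        field_simp

/-- **THE HOLONOMY ∕ LOOP-DEFECT CHAIN INHABITED WITH `θ = L^{1−d} < 1`**: in the abelian block model, for every domain-free
configuration `V` of any level `k`, every `n` with `k + n ≤ m + K` and every closed walk of length `|w|` at level `k + n`,
`0 ≤ 1 − cos(phase of 𝒰_w(avgⁿ V)) ≤ ½ · (|w| · tv(1, V) · (L^{1−d})ⁿ)²` — generation 3's `LoopDefectBound` with EVERY hypothesis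
discharged (`ReTrCrit` = `1 − cos x ≤ x²/2`; `DomStable`/`GaugeStable` trivial on `univ`; NE1a-STEP = `avgStepContraction_linAvg`;
`AvgFlat` = `avgFlat_linAvg`).  Rate per level in the defect: `θ² = L^{2−2d}`. [folklore] -/
theorem loopDefectBound_linAvg :
    LoopDefectBound (fun k => (linAvg : Averaging P k LinPhase)) (fun _ => Set.univ) (1 / 2) (theta P) :=
  loopDefectBound_of_stepContraction LinPhase.reTrCrit (by norm_num) (domStable_univ _) gaugeStable_univ
    avgStepContraction_linAvg (theta_nonneg P) avgFlat_linAvg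

/-- The same, unfolded: an explicit inequality between real numbers, no hypothesis left. [folklore] -/
theorem loopDefect_linAvg_explicit {k n : ℕ} (hn : k + n ≤ P.m + P.K) (x : Site P (k + n)) (w : List (Letter P.d))
    (hw : walkEnd x w = x) (V : GaugeField P k LinPhase) :
    1 - Real.cos (holAt (iterFrom (fun k => (linAvg : Averaging P k LinPhase)) k n V) (walk x w)).ph
      ≤ 1 / 2 * ((w.length : ℝ) * tv 1 V * theta P ^ n) ^ 2 :=
  loopDefectBound_linAvg k n hn x w hw V (Set.mem_univ _) (Set.mem_univ _)

/-- **`HolDevBound` INHABITED WITH `θ = L^{1−d}`** (the gauge-invariant holonomy-level shape of `QLaHolonomyDefect`, `Ch = 1`):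
in the abelian block model the closed-walk holonomy phase of `avgⁿ V` is within `|w| · tv(1, V) · (L^{1−d})ⁿ` of `0`, for every
configuration — by `holDevBound_of_stepContraction` from `avgStepContraction_linAvg`. [folklore] -/
theorem holDevBound_linAvg :
    HolDevBound (fun k => (linAvg : Averaging P k LinPhase)) (fun _ => Set.univ) 1 (theta P) :=
  holDevBound_of_stepContraction (domStable_univ _) gaugeStable_univ avgStepContraction_linAvg (theta_nonneg P) avgFlat_linAvg

/-- **THE NODE-S CHAIN END TO END IN THE MODEL — the `t`-discrepancy of ANY log-quotient decays like `(L^{2−2d})ⁿ`.**  For any two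
probability laws `ν₁, ν₂` on a parameter space `Ω` of level-`k` configurations `cfg ω` supported in a finite bond set `Λ` with
one-bond deviations `≤ D` (the normalised numerator and denominator fibre laws of ONE large-field quotient at the trivial exterior —
WHICH laws is NODE O's business; only measurability of the rider is asked), and the rider exponent `G = W_w(avgⁿ ·) − 1` of a closed
walk `w` at level `k + n` under the abelian block averaging:
`|log ∫ e^{tG} dν₁ − log ∫ e^{tG} dν₂| ≤ 2|t| · ½(|w|·|Λ|·D)² · (θ²)ⁿ`, `θ = L^{1−d}` — generation 3's `abs_log_integral_exp_sub_le` ∘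
`loopDefect_le_of_support` with every averaging hypothesis DISCHARGED by `loopDefectBound_linAvg`.  Per-component shape `QLaPt` with
`b = θ² = L^{2−2d}`; with the census `Λ = L^d`, `a = L^{2−d}` (`theta_sq_mul_vol`). [folklore] -/
theorem abs_log_quotient_sub_le_linAvg {Ω : Type*} [MeasurableSpace Ω] (ν₁ ν₂ : MeasureTheory.Measure Ω)
    [MeasureTheory.IsProbabilityMeasure ν₁] [MeasureTheory.IsProbabilityMeasure ν₂] {k n : ℕ} (hn : k + n ≤ P.m + P.K)
    (x : Site P (k + n)) (w : List (Letter P.d)) (hw : walkEnd x w = x) (cfg : Ω → GaugeField P k LinPhase)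
    (Λ : Finset (PBond P k)) {D : ℝ} (hoff : ∀ ω b, b ∉ Λ → cfg ω b = 1) (hD : ∀ ω, ∀ b ∈ Λ, dist1 (cfg ω b) ≤ D)
    (hG₁ : MeasureTheory.AEStronglyMeasurable
      (fun ω => loopAt (iterFrom (fun k => (linAvg : Averaging P k LinPhase)) k n (cfg ω)) (walk x w) - 1) ν₁)
    (hG₂ : MeasureTheory.AEStronglyMeasurable
      (fun ω => loopAt (iterFrom (fun k => (linAvg : Averaging P k LinPhase)) k n (cfg ω)) (walk x w) - 1) ν₂)
    (t : ℝ) :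
    |Real.log (∫ ω, Real.exp (t * (loopAt (iterFrom (fun k => (linAvg : Averaging P k LinPhase)) k n (cfg ω)) (walk x w) - 1)) ∂ν₁)
      - Real.log (∫ ω, Real.exp (t * (loopAt (iterFrom (fun k => (linAvg : Averaging P k LinPhase)) k n (cfg ω)) (walk x w) - 1)) ∂ν₂)|
      ≤ 2 * (|t| * (1 / 2 * ((w.length : ℝ) * Λ.card * D) ^ 2 * (theta P ^ 2) ^ n)) := by
  have key : ∀ ω, |loopAt (iterFrom (fun k => (linAvg : Averaging P k LinPhase)) k n (cfg ω)) (walk x w) - 1|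
      ≤ 1 / 2 * ((w.length : ℝ) * Λ.card * D) ^ 2 * (theta P ^ 2) ^ n := fun ω => by
    have h := loopDefect_le_of_support loopDefectBound_linAvg (by norm_num) (theta_nonneg P) hn x w hw (cfg ω)
      (Set.mem_univ _) (Set.mem_univ _) Λ (fun b hb => hoff ω b hb) (hD ω)
    have h0 := loopDefect_nonneg (iterFrom (fun k => (linAvg : Averaging P k LinPhase)) k n (cfg ω)) (walk x w)
    rw [abs_le]
    constructor <;> linarith
  exact abs_log_integral_exp_sub_le ν₁ ν₂ hG₁ hG₂ (MeasureTheory.ae_of_all _ key) (MeasureTheory.ae_of_all _ key) t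

/-! ### The NODE-S exponent: `a = θ² · Λ` with the census `Λ = L^d` is `L^{2−d}`; in `d = 4`, `θ = L⁻³ = θ₁` and `a = L⁻² < 1` -/

/-- `θ² · L^d = L² · L^{−d} = L^{2−d}`: the SECOND-order currency `b = θ²` of row NE1′ times the (0.26)-type component census
`Λ = L^d` (`T4RecentScale.Multiplicity`, `Spine.NE7.qla_of_pt_multiplicity`). [folklore] -/
theorem theta_sq_mul_vol (P : Params) : theta P ^ 2 * (P.L : ℝ) ^ P.d = (P.L : ℝ) ^ 2 * ((P.L : ℝ) ^ P.d)⁻¹ := by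
  have hL : (P.L : ℝ) ≠ 0 := Nat.cast_ne_zero.mpr P.L_pos.ne'
  unfold theta
  field_simp

/-- In `d = 4` the model's one-step rate is `θ = L⁻³ = θ₁`, the exact rate of `T4LoopPullback.theta1_exact` and the value the
currency lemmas of `Spine/NE7/QLaBudget` are written in. [folklore] -/
theorem theta_eq_of_d_eq_four (hd : P.d = 4) : theta P = (P.L : ℝ)⁻¹ ^ 3 := by
  have hL : (P.L : ℝ) ≠ 0 := Nat.cast_ne_zero.mpr P.L_pos.ne'
  rw [theta, hd]
  field_simp

/-- **`a = θ²·L⁴ = L⁻² < 1` IN `d = 4`** — the letter `a < 1` of route 1's END (`Spine.NE7.rate_secondOrder_lt_one`, p340302) holds for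
the rate REALISED by the abelian block model: the NODE-S chain criticality → `QLaPt` (b = θ²) → `QLa` (a = θ²Λ) is inhabited with
the summable exponent. [folklore] -/
theorem rate_linAvg_lt_one (hd : P.d = 4) : theta P ^ 2 * (P.L : ℝ) ^ P.d < 1 := by
  rw [theta_eq_of_d_eq_four hd, hd]
  exact rate_secondOrder_lt_one (by exact_mod_cast P.hL.2)

/-- SANITY (decided arithmetic): at `d = 4`, `L = 3` the model's one-step rate is `θ = 3·3⁻⁴ = 1/27` — the value the
`pub-balaban` cell's SU(2) one-step toy measures at the flat configuration for the segment bond classes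
(`t4/T4-RUNG-O3c1.md` PART C: «1/27 at L = 3 for the segment classes»). [folklore] -/
example : theta ⟨4, 3, 1, 1, by norm_num, ⟨1, rfl⟩, by norm_num⟩ = (27 : ℝ)⁻¹ := by
  norm_num [theta]

end Contraction
end Summit.QuantumFields.BalabanUV.T4Continuum.Spine.NE7

end
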